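import Summits.QuantumFields.BalabanUV.Beta.FP.ConstrainedBiLaplacianResponseTwoLevel
import Summits.QuantumFields.BalabanUV.Beta.GAN24.SubAveragingFibre

/-!
# `BalabanUV.Beta.FP.ConstrainedBiLaplacianResponseTwoLevelSymbols` — road «FP» for binder row D1, DESIGN ROW **GHOST-STEP** brick (g3)
# «(CONV-C)-Hb», THE CONVERGENCE HALF, FILE 6b — THE SYMBOL ESTIMATES AT ORDER `s = 2`: the transferred inverse symbol `T2_k` is the coarse
# `ainv n 2 k` up to `C2(d,L)∕n²` uniformly in `k ≠ 0`; the far part above `0`, the zero-alias weight, the squared unshifted symbols and the two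
# denominators agree to `O(n^{−2})` on the fat region, for every `n, L ≥ 1`

NOT IN PRINT; OUR PROOF ATTEMPT (binder row G-an2-4 ∕ (CONV-C), prover part P3 = fibre∕strip «Woodbury» lineage, gen 28; CRUX TEAM (2),
2026-08-21).  HONEST DEPENDENCY (cell records, verbatim): «continuum YM on T⁴ ⇐ BetaPertH ∧ nine spine estimates (0/9 proved); BetaPertH ⇐ (D1) ∧
(D4) ∧ CAP+tail; G-an2-4 gates asym, D1 and NE2/3/4.»  HONEST FRAMING (cell contract, verbatim): «discharging `BetaPertH` makes Bałaban's UV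
stability UNCONDITIONAL — a real constructive-QFT result; it is NOT the continuum limit and NOT the Clay problem.»  ABSOLUTE RULE (cell charter,
verbatim): «No internally-minted statement may enter as a cited fact. Every hypothesis is either kernel-proved in this package or a verbatim quotation
of a PUBLISHED theorem with page reference. The manuscript(s) under audit are NOT citable for their own disputed steps — they are the thing under
adjudication; programme-internal (2001/route/tribunal) claims are never citable.»  THIS MODULE is [folklore] inequality bookkeeping over the lineage's
gen-22 «SUBAVG-RATE» core (`SubAveragingCoreEstimate.norm_A_sub_A'_le` ∕ `norm_W1_mstar_sub_one_le` ∕ `norm_W1_le` ∕ `Om_le` ∕ `Om_le'`,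
`SubAveragingCore.W_Kof_far` ∕ `W_Kof_mstar` ∕ `Kof_ne_zero`, `SubAveragingFibre.norm_DeltaXi_mul_sub_le` ∕ `Mstar_zero`), the vendored [B4] symbol
bounds (`re_DeltaXi_shift_ge_W`, `norm_DeltaXi_le`, `sum_norm_U_le`) and the lineage's FILES 1–2a of row RHOA-4-GH (`norm_den_ge_strip`, `norm_ainv_le`,
`norm_Spr_le`); it cites nothing as a hypothesis, has TWO bookkeeping `def`s (the constants `C2`, `Cden`), no `def … : Prop`, no `sorry`.

## The estimate (mechanism: the lineage's core at order 2)

For `k ≠ 0`, `T2_k − a_k²` (`a_k = 1∕Δ^ξ(p′+2πk)`) splits into the PRINCIPAL sub-alias `m⋆ = Mstar k` — where `W1(K⋆) = 1 + O(Ω∕n²)`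
(`norm_W1_mstar_sub_one_le`), `Δ^{ξ∕L}(p′+2πK⋆) = Δ^ξ(p′+2πk) + O(Ω²∕n²)` (`norm_A_sub_A'_le`), both symbols `≥ (7∕64)·W_n(k)` (`W_Kof_mstar`) and
`Ω ≤ (d+1)W_n(k)` — and the FAR sub-aliases, each `≤ 4^d·((64∕7)∕W_{nL}(K))²` with `W_{nL}(K) ≥ n²∕4` (`W_Kof_far`): **`norm_T2_sub_le`**
(`‖T2 n L 2 p k − ainv n 2 k p‖ ≤ C2(d,L)∕n²`), `norm_T2far_le`; at `k = 0`: `‖W1(Kof 0 0) − 1‖ ≤ 4^d·91·d∕n²`; the unshifted symbols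
`‖(Δ^{ξ∕L})² − (Δ^ξ)²‖ ≤ 16384·d²∕n²`; the denominators `‖den (n·L) 2 − den n 2‖ ≤ Cden(d,L)∕n²` (FILE 6a's `den_mul_eq`) with both `≥ cB` on the
strip.  FILE 6c (`…TwoLevelEstimate`) assembles `‖betaT_k − beta_k‖ ≤ Cb∕n²` and the symbol of the one-step law of the block-sum response.

0∕4 row-D1 binders touched.  NOT (CONV-C), NEVER «G-an2-4 closed», NOT the ghost step law, NOT SDF, NOT D1, NOT BetaPertH, NOT continuum, NOT Clay.
Provenance: prover-b2b-balaban-gan24-p3-g28-0 (unit `b2b-balaban-gan24-p3`, gen 28), 2026-08-21; no existing file touched.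
-/

noncomputable section

namespace Summit.QuantumFields.BalabanUV.Beta.FP.ConstrainedBiLaplacianResponseTwoLevelSymbols

open Complex Finset ComplexConjugate
open Literature.MathematicalPhysics.QuantumFieldTheory.Balaban1983to89
open Literature.MathematicalPhysics.QuantumFieldTheory.Balaban1983to89.B4Strip
open Literature.MathematicalPhysics.QuantumFieldTheory.Balaban1983to89.B4StripCauchy
open Literature.MathematicalPhysics.QuantumFieldTheory.Balaban1983to89.B5Strip145Analytic
open Literature.MathematicalPhysics.QuantumFieldTheory.Balaban1983to89.B4StripSums
open Summit.QuantumFields.BalabanUV.Beta.FP.ConstrainedBiLaplacianStrip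
open Summit.QuantumFields.BalabanUV.Beta.FP.ConstrainedBiLaplacianFibre
open Summit.QuantumFields.BalabanUV.Beta.FP.ConstrainedBiLaplacianFibreEntries
open Summit.QuantumFields.BalabanUV.Beta.FP.ConstrainedBiLaplacianFibreSides
open Summit.QuantumFields.BalabanUV.Beta.FP.ConstrainedBiLaplacianKernel
open Summit.QuantumFields.BalabanUV.Beta.FP.ConstrainedBiLaplacianFibreIdentities
open Summit.QuantumFields.BalabanUV.Beta.FP.ConstrainedBiLaplacianResponse
open Summit.QuantumFields.BalabanUV.Beta.FP.ConstrainedBiLaplacianResponseTwoLevel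
open Summit.QuantumFields.BalabanUV.Beta.GAN24.SubAveragingDirichlet (sw)
open Summit.QuantumFields.BalabanUV.Beta.GAN24.SubAveragingCore (Kof Kof_val Kof_ne_zero Mstar W_Kof_far W_Kof_mstar)
open Summit.QuantumFields.BalabanUV.Beta.GAN24.SubAveragingCoreEstimate (W1 norm_W1_le Om Om_le Om_le' norm_A_sub_A'_le norm_W1_mstar_sub_one_le)
open Summit.QuantumFields.BalabanUV.Beta.GAN24.SubAveragingFibre (Kof_zero Mstar_zero norm_DeltaXi_mul_sub_le)
open scoped Real

variable {d : ℕ}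

/-! ## §0 Elementary facts on the fat region -/

/-- [folklore] `Ω_n(0) = d`. -/
theorem Om_zero (n : ℕ) [NeZero n] : Om n (fun _ : Fin d => (0 : Fin n)) = d := by
  have hn : 1 ≤ n := Nat.pos_of_ne_zero (NeZero.ne n)
  unfold Om
  simp [omega_zero n hn]

/-- [folklore] each continued `|u_k|²` is bounded by the residue-sum constant: `‖U n k q‖ ≤ 132^d`. -/
theorem norm_U_le_const (n : ℕ) [NeZero n] {r : ℝ} (hr : r ≤ 1 / 4) {q : Fin d → ℂ} (hq : q ∈ Fat d r) (k : Fin d → Fin n) :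
    ‖U n k q‖ ≤ 132 ^ d :=
  (Finset.single_le_sum (f := fun k => ‖U n k q‖) (fun _ _ => norm_nonneg _) (Finset.mem_univ k)).trans (sum_norm_U_le n hr hq)

/-- [folklore] `|Im p_ν| ≤ 1` on the fat region (`r ≤ 1∕4`). -/
theorem im_le_one {r : ℝ} (hr : r ≤ 1 / 4) {p : Fin d → ℂ} (hp : p ∈ Fat d r) (ν : Fin d) : |(p ν).im| ≤ 1 := by
  have := (hp ν).2; linarith

/-- [folklore] for `k ≠ 0` the shifted symbol is at least `(7∕64)·W_n(k) ≥ 7∕64` in norm. -/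
theorem norm_shift_ge (n : ℕ) [NeZero n] {r : ℝ} (hr : r ≤ 1 / 4) (hdr : (d : ℝ) * r ^ 2 ≤ 1 / 16) {p : Fin d → ℂ} (hp : p ∈ Fat d r)
    {k : Fin d → Fin n} (hk : k ≠ fun _ => 0) : 7 / 64 * W n k ≤ ‖DeltaXi n 0 (shift n k p)‖ :=
  (re_DeltaXi_shift_ge_W n 0 le_rfl hr hdr hp k hk).trans (Complex.re_le_norm _)

/-! ## §1 The transferred inverse symbol at order 2 -/

/-- [folklore] The constant of `norm_T2_sub_le`. -/
def C2 (d L : ℕ) : ℝ := 4 ^ d * 91 * ((d : ℝ) + 1) * (64 / 7) ^ 2 + 2 * 29282 * ((d : ℝ) + 1) ^ 2 * (64 / 7) ^ 3 + (L : ℝ) ^ d * 4 ^ (d + 2) * (64 / 7) ^ 2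

/-- [folklore] `0 ≤ C2`. -/
theorem C2_nonneg (d L : ℕ) : 0 ≤ C2 d L := by unfold C2; positivity

/-- [folklore] elementary: for `0 < w ≤ a, b`: `(a + b) ∕ (a² b²) ≤ 2 ∕ w³`. -/
theorem add_div_sq_sq_le {w a b : ℝ} (hw : 0 < w) (ha : w ≤ a) (hb : w ≤ b) : (a + b) / (a ^ 2 * b ^ 2) ≤ 2 / w ^ 3 := by
  have ha0 : 0 < a := lt_of_lt_of_le hw ha
  have hb0 : 0 < b := lt_of_lt_of_le hw hb
  rw [div_le_div_iff₀ (by positivity) (by positivity)]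
  have i1 : w ^ 3 ≤ a * b ^ 2 := by
    calc w ^ 3 = w * w ^ 2 := by ring
      _ ≤ a * b ^ 2 := mul_le_mul ha (pow_le_pow_left₀ hw.le hb 2) (by positivity) ha0.le
  have i2 : w ^ 3 ≤ a ^ 2 * b := by
    calc w ^ 3 = w ^ 2 * w := by ring
      _ ≤ a ^ 2 * b := mul_le_mul (pow_le_pow_left₀ hw.le ha 2) hb hw.le (by positivity)
  nlinarith [mul_le_mul_of_nonneg_left i1 ha0.le, mul_le_mul_of_nonneg_left i2 hb0.le]

/-- [folklore] **THE PRINCIPAL SUB-ALIAS, SQUARED SYMBOLS**: `‖ainv (n·L) 2 K⋆ − ainv n 2 k‖ ≤ 2·29282·(d+1)²·(64∕7)³∕n²` for `k ≠ 0`. -/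
theorem norm_ainv_mstar_sub_le (n L : ℕ) [NeZero n] [NeZero L] {r : ℝ} (hr : r ≤ 1 / 4) (hdr : (d : ℝ) * r ^ 2 ≤ 1 / 16)
    {p : Fin d → ℂ} (hp : p ∈ Fat d r) {k : Fin d → Fin n} (hk : k ≠ fun _ => 0) :
    ‖ainv (n * L) 2 (Kof n L k (Mstar n L k)) p - ainv n 2 k p‖ ≤ 2 * 29282 * ((d : ℝ) + 1) ^ 2 * (64 / 7) ^ 3 / (n : ℝ) ^ 2 := by
  have hn : 1 ≤ n := Nat.pos_of_ne_zero (NeZero.ne n)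
  have hn0 : (0 : ℝ) < n := by exact_mod_cast hn
  set A := DeltaXi n 0 (shift n k p) with hA
  set A' := DeltaXi (n * L) 0 (shift (n * L) (Kof n L k (Mstar n L k)) p) with hA'
  have hW1 : 1 ≤ W n k := one_le_W n k hk
  have hW0 : 0 < W n k := by linarith
  set w : ℝ := 7 / 64 * W n k with hw
  have hwpos : 0 < w := by positivity
  have hAge : w ≤ ‖A‖ := norm_shift_ge n hr hdr hp hk
  have hA'ge : w ≤ ‖A'‖ := by
    have h := norm_shift_ge (n * L) hr hdr hp (Kof_ne_zero n L hk (Mstar n L k))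
    rwa [W_Kof_mstar] at h
  have hAne : A ≠ 0 := norm_pos_iff.mp (lt_of_lt_of_le hwpos hAge)
  have hA'ne : A' ≠ 0 := norm_pos_iff.mp (lt_of_lt_of_le hwpos hA'ge)
  have hdiff : ‖A - A'‖ ≤ 29282 * Om n k ^ 2 / (n : ℝ) ^ 2 := norm_A_sub_A'_le n L 0 hr hp k
  have hOm : Om n k ≤ ((d : ℝ) + 1) * W n k := Om_le' n k hk
  have hOm0 : 0 ≤ Om n k := by unfold Om; positivity
  have e : (A' ^ 2)⁻¹ - (A ^ 2)⁻¹ = (A - A') * ((A + A') / (A ^ 2 * A' ^ 2)) := by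
    field_simp
    ring
  unfold ainv
  rw [e, norm_mul, norm_div, norm_mul, norm_pow, norm_pow]
  have hfrac : ‖A + A'‖ / (‖A‖ ^ 2 * ‖A'‖ ^ 2) ≤ 2 / w ^ 3 :=
    (div_le_div_of_nonneg_right (norm_add_le A A') (by positivity)).trans (add_div_sq_sq_le hwpos hAge hA'ge)
  have hOW : Om n k ^ 2 / w ^ 3 ≤ ((d : ℝ) + 1) ^ 2 * (64 / 7) ^ 3 := by
    rw [div_le_iff₀ (by positivity), hw]
    have h1 : Om n k ^ 2 ≤ (((d : ℝ) + 1) * W n k) ^ 2 := pow_le_pow_left₀ hOm0 hOm 2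
    have h2 : (((d : ℝ) + 1) * W n k) ^ 2 ≤ ((d : ℝ) + 1) ^ 2 * (64 / 7) ^ 3 * (7 / 64 * W n k) ^ 3 := by
      have : W n k ^ 2 ≤ W n k ^ 3 := by nlinarith [pow_pos hW0 2]
      nlinarith [this, sq_nonneg ((d : ℝ) + 1)]
    exact h1.trans h2
  calc ‖A - A'‖ * (‖A + A'‖ / (‖A‖ ^ 2 * ‖A'‖ ^ 2))
      ≤ (29282 * Om n k ^ 2 / (n : ℝ) ^ 2) * (2 / w ^ 3) := mul_le_mul hdiff hfrac (by positivity) (by positivity)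
    _ = 2 * 29282 * (Om n k ^ 2 / w ^ 3) / (n : ℝ) ^ 2 := by field_simp
    _ ≤ 2 * 29282 * (((d : ℝ) + 1) ^ 2 * (64 / 7) ^ 3) / (n : ℝ) ^ 2 := by gcongr
    _ = 2 * 29282 * ((d : ℝ) + 1) ^ 2 * (64 / 7) ^ 3 / (n : ℝ) ^ 2 := by ring

/-- [folklore] **THE FAR SUB-ALIASES AT ORDER 2**: `‖Σ_{m ≠ M⋆} W1(Kof k m)·ainv (n·L) 2 (Kof k m)‖ ≤ L^d·4^{d+2}·(64∕7)²∕n²` — for ANY `k` (far finer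
aliases have `W_{nL} ≥ n²∕4`). -/
theorem norm_far_le (n L : ℕ) [NeZero n] [NeZero L] {r : ℝ} (hr : r ≤ 1 / 4) (hdr : (d : ℝ) * r ^ 2 ≤ 1 / 16)
    {p : Fin d → ℂ} (hp : p ∈ Fat d r) (k : Fin d → Fin n) :
    ‖∑ m ∈ Finset.univ.erase (Mstar n L k), W1 n L (Kof n L k m) p * ainv (n * L) 2 (Kof n L k m) p‖
      ≤ (L : ℝ) ^ d * 4 ^ (d + 2) * (64 / 7) ^ 2 / (n : ℝ) ^ 2 := by
  have hn : 1 ≤ n := Nat.pos_of_ne_zero (NeZero.ne n)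
  have hL : 1 ≤ L := Nat.pos_of_ne_zero (NeZero.ne L)
  have hn0 : (0 : ℝ) < n := by exact_mod_cast hn
  have hn1 : (1 : ℝ) ≤ n := by exact_mod_cast hn
  have him : ∀ ν, |(p ν).im| ≤ 1 := im_le_one hr hp
  have hterm : ∀ m ∈ Finset.univ.erase (Mstar n L k),
      ‖W1 n L (Kof n L k m) p * ainv (n * L) 2 (Kof n L k m) p‖ ≤ 4 ^ d * ((64 / 7) * (4 / (n : ℝ) ^ 2)) ^ 2 := by
    intro m hm
    have hfar : (n : ℝ) ^ 2 / 4 ≤ W (n * L) (Kof n L k m) := W_Kof_far n L k m (Finset.ne_of_mem_erase hm)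
    have hq : (0 : ℝ) < (n : ℝ) ^ 2 / 4 := by positivity
    have hKne : Kof n L k m ≠ fun _ => 0 := by
      intro h0
      have : W (n * L) (Kof n L k m) = 0 := by rw [h0]; exact B4StripSumsHolder.W_zero (n * L)
      rw [this] at hfar
      linarith
    rw [norm_mul]
    refine mul_le_mul (norm_W1_le n L hn hL _ him) ?_ (norm_nonneg _) (by positivity)
    have h := norm_ainv_le (n * L) 2 hr hdr hp (Kof n L k m) hKne
    refine h.trans (pow_le_pow_left₀ (div_nonneg (by norm_num) (hq.le.trans hfar)) ?_ 2)
    calc (64 / 7 : ℝ) / W (n * L) (Kof n L k m) ≤ (64 / 7) / ((n : ℝ) ^ 2 / 4) := div_le_div_of_nonneg_left (by norm_num) hq hfar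
      _ = (64 / 7) * (4 / (n : ℝ) ^ 2) := by field_simp
  calc ‖∑ m ∈ Finset.univ.erase (Mstar n L k), W1 n L (Kof n L k m) p * ainv (n * L) 2 (Kof n L k m) p‖
      ≤ ∑ m ∈ Finset.univ.erase (Mstar n L k), ‖W1 n L (Kof n L k m) p * ainv (n * L) 2 (Kof n L k m) p‖ := norm_sum_le _ _
    _ ≤ ∑ m ∈ Finset.univ.erase (Mstar n L k), 4 ^ d * ((64 / 7) * (4 / (n : ℝ) ^ 2)) ^ 2 := Finset.sum_le_sum hterm
    _ ≤ ∑ _m : Fin d → Fin L, 4 ^ d * ((64 / 7) * (4 / (n : ℝ) ^ 2)) ^ 2 :=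
        Finset.sum_le_sum_of_subset_of_nonneg (Finset.erase_subset _ _) (fun _ _ _ => by positivity)
    _ = (L : ℝ) ^ d * (4 ^ d * ((64 / 7) * (4 / (n : ℝ) ^ 2)) ^ 2) := by
        rw [Finset.sum_const, Finset.card_univ, Fintype.card_pi, Fintype.card_fin, Finset.prod_const, Finset.card_univ,
          Fintype.card_fin, nsmul_eq_mul]; push_cast; ring
    _ = (L : ℝ) ^ d * 4 ^ (d + 2) * (64 / 7) ^ 2 / (n : ℝ) ^ 2 * (1 / (n : ℝ) ^ 2) := by
        field_simp; ring
    _ ≤ (L : ℝ) ^ d * 4 ^ (d + 2) * (64 / 7) ^ 2 / (n : ℝ) ^ 2 * 1 := by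
        gcongr
        rw [div_le_one (by positivity)]
        exact one_le_pow₀ hn1
    _ = _ := mul_one _

/-- [folklore] **THE TRANSFERRED INVERSE SYMBOL AT ORDER 2 IS THE COARSE ONE UP TO `C2∕n²`**: for `k ≠ 0` and `p ∈ Fat d r` (`r ≤ 1∕4`,
`d r² ≤ 1∕16`), `‖T2 n L 2 p k − ainv n 2 k p‖ ≤ C2 d L∕n²`. -/
theorem norm_T2_sub_le (n L : ℕ) [NeZero n] [NeZero L] {r : ℝ} (hr : r ≤ 1 / 4) (hdr : (d : ℝ) * r ^ 2 ≤ 1 / 16)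
    {p : Fin d → ℂ} (hp : p ∈ Fat d r) {k : Fin d → Fin n} (hk : k ≠ fun _ => 0) :
    ‖T2 n L 2 p k - ainv n 2 k p‖ ≤ C2 d L / (n : ℝ) ^ 2 := by
  have hn : 1 ≤ n := Nat.pos_of_ne_zero (NeZero.ne n)
  have hn0 : (0 : ℝ) < n := by exact_mod_cast hn
  have hW1 : 1 ≤ W n k := one_le_W n k hk
  have hW0 : 0 < W n k := by linarith
  have hsplit : T2 n L 2 p k = W1 n L (Kof n L k (Mstar n L k)) p * ainv (n * L) 2 (Kof n L k (Mstar n L k)) p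
      + ∑ m ∈ Finset.univ.erase (Mstar n L k), W1 n L (Kof n L k m) p * ainv (n * L) 2 (Kof n L k m) p := by
    unfold T2; rw [← Finset.add_sum_erase _ _ (Finset.mem_univ (Mstar n L k))]
  -- principal sub-alias
  have ha' : ‖ainv (n * L) 2 (Kof n L k (Mstar n L k)) p‖ ≤ ((64 / 7) / W n k) ^ 2 := by
    have h := norm_ainv_le (n * L) 2 hr hdr hp (Kof n L k (Mstar n L k)) (Kof_ne_zero n L hk _)
    rwa [W_Kof_mstar] at h
  have hW1m : ‖W1 n L (Kof n L k (Mstar n L k)) p - 1‖ ≤ 4 ^ d * 91 * Om n k / (n : ℝ) ^ 2 := norm_W1_mstar_sub_one_le n L hr hp k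
  have hOm : Om n k ≤ ((d : ℝ) + 1) * W n k := Om_le' n k hk
  have hOm0 : 0 ≤ Om n k := by unfold Om; positivity
  have hA : ‖(W1 n L (Kof n L k (Mstar n L k)) p - 1) * ainv (n * L) 2 (Kof n L k (Mstar n L k)) p‖
      ≤ 4 ^ d * 91 * ((d : ℝ) + 1) * (64 / 7) ^ 2 / (n : ℝ) ^ 2 := by
    rw [norm_mul]
    calc ‖W1 n L (Kof n L k (Mstar n L k)) p - 1‖ * ‖ainv (n * L) 2 (Kof n L k (Mstar n L k)) p‖
        ≤ (4 ^ d * 91 * Om n k / (n : ℝ) ^ 2) * ((64 / 7) / W n k) ^ 2 := mul_le_mul hW1m ha' (norm_nonneg _) (by positivity)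
      _ = 4 ^ d * 91 * (64 / 7) ^ 2 / (n : ℝ) ^ 2 * (Om n k / W n k ^ 2) := by field_simp
      _ ≤ 4 ^ d * 91 * (64 / 7) ^ 2 / (n : ℝ) ^ 2 * ((d : ℝ) + 1) := by
          gcongr
          rw [div_le_iff₀ (by positivity)]
          nlinarith [hOm, hW1, pow_pos hW0 2]
      _ = 4 ^ d * 91 * ((d : ℝ) + 1) * (64 / 7) ^ 2 / (n : ℝ) ^ 2 := by ring
  have hB := norm_ainv_mstar_sub_le n L hr hdr hp hk
  have hC := norm_far_le n L hr hdr hp k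
  have e : T2 n L 2 p k - ainv n 2 k p
      = (W1 n L (Kof n L k (Mstar n L k)) p - 1) * ainv (n * L) 2 (Kof n L k (Mstar n L k)) p
        + (ainv (n * L) 2 (Kof n L k (Mstar n L k)) p - ainv n 2 k p)
        + ∑ m ∈ Finset.univ.erase (Mstar n L k), W1 n L (Kof n L k m) p * ainv (n * L) 2 (Kof n L k m) p := by
    rw [hsplit]; ring
  rw [e]
  refine (norm_add_le _ _).trans ((add_le_add ((norm_add_le _ _).trans (add_le_add hA hB)) hC).trans ?_)
  unfold C2
  rw [← add_div, ← add_div]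

/-- [folklore] **THE FAR PART ABOVE THE ZERO ALIAS**: `‖T2far n L 2 p‖ ≤ L^d·4^{d+2}·(64∕7)²∕n²` (`Mstar 0 = 0`). -/
theorem norm_T2far_le (n L : ℕ) [NeZero n] [NeZero L] {r : ℝ} (hr : r ≤ 1 / 4) (hdr : (d : ℝ) * r ^ 2 ≤ 1 / 16)
    {p : Fin d → ℂ} (hp : p ∈ Fat d r) : ‖T2far n L 2 p‖ ≤ (L : ℝ) ^ d * 4 ^ (d + 2) * (64 / 7) ^ 2 / (n : ℝ) ^ 2 := by
  have h := norm_far_le n L hr hdr hp (fun _ : Fin d => (0 : Fin n))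
  rw [Mstar_zero] at h
  exact h

/-! ## §2 The zero alias, the unshifted symbols, the denominators -/

/-- [folklore] `‖W1(Kof 0 0) − 1‖ ≤ 4^d·91·d∕n²`. -/
theorem norm_W1_zero_sub_one_le (n L : ℕ) [NeZero n] [NeZero L] {r : ℝ} (hr : r ≤ 1 / 4) {p : Fin d → ℂ} (hp : p ∈ Fat d r) :
    ‖W1 n L (Kof n L (fun _ => (0 : Fin n)) (fun _ => (0 : Fin L))) p - 1‖ ≤ 4 ^ d * 91 * (d : ℝ) / (n : ℝ) ^ 2 := by
  have h := norm_W1_mstar_sub_one_le n L hr hp (fun _ : Fin d => (0 : Fin n))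
  rw [Mstar_zero, Om_zero] at h
  exact h

/-- [folklore] `‖(Δ^{ξ∕L}(p))² − (Δ^ξ(p))²‖ ≤ 16384·d²∕n²` (`norm_DeltaXi_mul_sub_le` and `‖Δ^ξ‖ ≤ 16d`). -/
theorem norm_DeltaXi_sq_sub_le (n L : ℕ) [NeZero n] [NeZero L] {r : ℝ} (hr : r ≤ 1 / 4) {p : Fin d → ℂ} (hp : p ∈ Fat d r) :
    ‖DeltaXi (n * L) 0 p ^ 2 - DeltaXi n 0 p ^ 2‖ ≤ 16384 * (d : ℝ) ^ 2 / (n : ℝ) ^ 2 := by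
  have hn : 1 ≤ n := Nat.pos_of_ne_zero (NeZero.ne n)
  have hnL : 1 ≤ n * L := Nat.pos_of_ne_zero (NeZero.ne (n * L))
  have h1 := norm_DeltaXi_mul_sub_le n L 0 hr hp
  have h2 := norm_DeltaXi_le n hn 0 le_rfl hr hp
  have h3 := norm_DeltaXi_le (n * L) hnL 0 le_rfl hr hp
  rw [add_zero] at h2 h3
  have e : DeltaXi (n * L) 0 p ^ 2 - DeltaXi n 0 p ^ 2 = (DeltaXi (n * L) 0 p - DeltaXi n 0 p) * (DeltaXi (n * L) 0 p + DeltaXi n 0 p) := by ring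
  rw [e, norm_mul]
  calc ‖DeltaXi (n * L) 0 p - DeltaXi n 0 p‖ * ‖DeltaXi (n * L) 0 p + DeltaXi n 0 p‖
      ≤ (512 * (d : ℝ) / (n : ℝ) ^ 2) * (16 * d + 16 * d) :=
        mul_le_mul h1 ((norm_add_le _ _).trans (add_le_add h3 h2)) (norm_nonneg _) (by positivity)
    _ = 16384 * (d : ℝ) ^ 2 / (n : ℝ) ^ 2 := by ring

/-- [folklore] The constant of the denominator comparison. -/
def Cden (d L : ℕ) : ℝ :=
  132 ^ d * (4 ^ d * 91 * (d : ℝ)) + 16384 * (d : ℝ) ^ 2 * (132 ^ d * (64 / 7) ^ 2)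
    + (16 * (d : ℝ)) ^ 2 * (132 ^ d * C2 d L + 132 ^ d * ((L : ℝ) ^ d * 4 ^ (d + 2) * (64 / 7) ^ 2))

/-- [folklore] `0 ≤ Cden`. -/
theorem Cden_nonneg (d L : ℕ) : 0 ≤ Cden d L := by unfold Cden; have := C2_nonneg d L; positivity

/-- [folklore] **THE TWO DENOMINATORS AGREE TO `Cden∕n²`** on the fat region (FILE 6a's `den_mul_eq` against `den = U_0 + (Δ^ξ)²·Spr`). -/
theorem norm_den_sub_den_le (n L : ℕ) [NeZero n] [NeZero L] {r : ℝ} (hr : r ≤ 1 / 4) (hdr : (d : ℝ) * r ^ 2 ≤ 1 / 16)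
    {p : Fin d → ℂ} (hp : p ∈ Fat d r) : ‖den (n * L) 2 p - den n 2 p‖ ≤ Cden d L / (n : ℝ) ^ 2 := by
  have hn : 1 ≤ n := Nat.pos_of_ne_zero (NeZero.ne n)
  have hnL : 1 ≤ n * L := Nat.pos_of_ne_zero (NeZero.ne (n * L))
  have hn0 : (0 : ℝ) < n := by exact_mod_cast hn
  have hU : ∀ k : Fin d → Fin n, ‖U n k p‖ ≤ 132 ^ d := norm_U_le_const n hr hp
  have hA' : ‖DeltaXi (n * L) 0 p‖ ≤ 16 * d := by have := norm_DeltaXi_le (n * L) hnL 0 le_rfl hr hp; rwa [add_zero] at this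
  have hSpr : ‖Spr n 2 p‖ ≤ 132 ^ d * (64 / 7) ^ 2 := norm_Spr_le n 2 hr hdr hp
  -- the difference, term by term
  have hS : ∑ k ∈ Finset.univ.erase (fun _ => (0 : Fin n)), U n k p * (T2 n L 2 p k - ainv n 2 k p)
      = (∑ k ∈ Finset.univ.erase (fun _ => (0 : Fin n)), U n k p * T2 n L 2 p k) - Spr n 2 p := by
    unfold Spr
    rw [← Finset.sum_sub_distrib]
    exact Finset.sum_congr rfl fun k _ => by ring
  have e : den (n * L) 2 p - den n 2 p
      = U n (fun _ => 0) p * (W1 n L (Kof n L (fun _ => 0) (fun _ => 0)) p - 1)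
        + (DeltaXi (n * L) 0 p ^ 2 - DeltaXi n 0 p ^ 2) * Spr n 2 p
        + DeltaXi (n * L) 0 p ^ 2 * (∑ k ∈ Finset.univ.erase (fun _ => (0 : Fin n)), U n k p * (T2 n L 2 p k - ainv n 2 k p)
            + U n (fun _ => 0) p * T2far n L 2 p) := by
    rw [den_mul_eq n L 2 p hr hp, den_eq_U_add_mul_Spr n 2 p, hS]
    ring
  rw [e]
  have hsum : ‖∑ k ∈ Finset.univ.erase (fun _ => (0 : Fin n)), U n k p * (T2 n L 2 p k - ainv n 2 k p)‖ ≤ 132 ^ d * C2 d L / (n : ℝ) ^ 2 := by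
    calc ‖∑ k ∈ Finset.univ.erase (fun _ => (0 : Fin n)), U n k p * (T2 n L 2 p k - ainv n 2 k p)‖
        ≤ ∑ k ∈ Finset.univ.erase (fun _ => (0 : Fin n)), ‖U n k p * (T2 n L 2 p k - ainv n 2 k p)‖ := norm_sum_le _ _
      _ ≤ ∑ k ∈ Finset.univ.erase (fun _ => (0 : Fin n)), ‖U n k p‖ * (C2 d L / (n : ℝ) ^ 2) :=
          Finset.sum_le_sum fun k hk => by
            rw [norm_mul]
            exact mul_le_mul_of_nonneg_left (norm_T2_sub_le n L hr hdr hp (Finset.ne_of_mem_erase hk)) (norm_nonneg _)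
      _ = (∑ k ∈ Finset.univ.erase (fun _ => (0 : Fin n)), ‖U n k p‖) * (C2 d L / (n : ℝ) ^ 2) := by rw [Finset.sum_mul]
      _ ≤ 132 ^ d * (C2 d L / (n : ℝ) ^ 2) := by
          refine mul_le_mul_of_nonneg_right ?_ (by have := C2_nonneg d L; positivity)
          exact (Finset.sum_le_sum_of_subset_of_nonneg (Finset.erase_subset _ _) (fun _ _ _ => norm_nonneg _)).trans
            (sum_norm_U_le n hr hp)
      _ = _ := by ring
  have h1 : ‖U n (fun _ => 0) p * (W1 n L (Kof n L (fun _ => 0) (fun _ => 0)) p - 1)‖ ≤ 132 ^ d * (4 ^ d * 91 * (d : ℝ) / (n : ℝ) ^ 2) := by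
    rw [norm_mul]; exact mul_le_mul (hU _) (norm_W1_zero_sub_one_le n L hr hp) (norm_nonneg _) (by positivity)
  have h2 : ‖(DeltaXi (n * L) 0 p ^ 2 - DeltaXi n 0 p ^ 2) * Spr n 2 p‖ ≤ (16384 * (d : ℝ) ^ 2 / (n : ℝ) ^ 2) * (132 ^ d * (64 / 7) ^ 2) := by
    rw [norm_mul]; exact mul_le_mul (norm_DeltaXi_sq_sub_le n L hr hp) hSpr (norm_nonneg _) (by positivity)
  have h3 : ‖DeltaXi (n * L) 0 p ^ 2 * (∑ k ∈ Finset.univ.erase (fun _ => (0 : Fin n)), U n k p * (T2 n L 2 p k - ainv n 2 k p)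
        + U n (fun _ => 0) p * T2far n L 2 p)‖
      ≤ (16 * (d : ℝ)) ^ 2 * (132 ^ d * C2 d L / (n : ℝ) ^ 2 + 132 ^ d * ((L : ℝ) ^ d * 4 ^ (d + 2) * (64 / 7) ^ 2 / (n : ℝ) ^ 2)) := by
    rw [norm_mul, norm_pow]
    refine mul_le_mul (pow_le_pow_left₀ (norm_nonneg _) hA' 2) ?_ (norm_nonneg _) (by positivity)
    refine (norm_add_le _ _).trans (add_le_add hsum ?_)
    rw [norm_mul]; exact mul_le_mul (hU _) (norm_T2far_le n L hr hdr hp) (norm_nonneg _) (by positivity)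
  refine (norm_add_le _ _).trans ((add_le_add ((norm_add_le _ _).trans (add_le_add h1 h2)) h3).trans ?_)
  unfold Cden
  have hC2 := C2_nonneg d L
  rw [show 132 ^ d * (4 ^ d * 91 * (d : ℝ) / (n : ℝ) ^ 2) + 16384 * (d : ℝ) ^ 2 / (n : ℝ) ^ 2 * (132 ^ d * (64 / 7) ^ 2)
      + (16 * (d : ℝ)) ^ 2 * (132 ^ d * C2 d L / (n : ℝ) ^ 2 + 132 ^ d * ((L : ℝ) ^ d * 4 ^ (d + 2) * (64 / 7) ^ 2 / (n : ℝ) ^ 2))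
      = (132 ^ d * (4 ^ d * 91 * (d : ℝ)) + 16384 * (d : ℝ) ^ 2 * (132 ^ d * (64 / 7) ^ 2)
        + (16 * (d : ℝ)) ^ 2 * (132 ^ d * C2 d L + 132 ^ d * ((L : ℝ) ^ d * 4 ^ (d + 2) * (64 / 7) ^ 2))) / (n : ℝ) ^ 2 by
      field_simp]

end Summit.QuantumFields.BalabanUV.Beta.FP.ConstrainedBiLaplacianResponseTwoLevelSymbols

end
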